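import Summits.PneNP.PneNP.Theorems.ConvexRankGatesConvexGateBlindCollapseSystem

/-!
# PneNP / ConvexRankGates — collapse of `{∧₂, ∨₂} ∪ CONV` circuits to ONE CONV gate, II

Helper development for the crux `ConvexGateBlind` (item `stmt-PneNP-10680`) of route
`ConvexRankGates` (`--supports`; closes nothing by itself). Main result:
`exists_oneConvGate_of_isOver` / `exists_oneGateCircuit_of_isOver` — **every circuit with `t`
gates over `{∧₂, ∨₂} ∪ CONV_s` on `n` inputs computes the same function as ONE CONV gate of size
parameter `4 (s + 3) (t + n + 1)²`**, the SDP-feasibility analogue of the max-existential weak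
MLP representation of MLP circuits (Oliveira–Pudlák 2019, Thm. 4.3, §7). The proof instantiates
the abstract soundness / completeness theorems of file I (`ConvCollapse.eval_of_levels`,
`ConvCollapse.exists_feasible`) with the explicit constraint matrices of the homogenised system
(sums of elementary matrices `Matrix.single`) and transports the data to `Fin`-indices
(`isConvGate_of_indexed`).
-/

namespace Summit.PneNP.PneNP.Theorems

open Literature.Computability.Complexity Matrix Finset

/-! ### Size bookkeeping and the collapse theorem -/

/-- Size bookkeeping: with `t` gates of `p j ≤ Q ≤ s + 1` rows each and `n` inputs, the single
system has at most `4 (s + 3) (t + n + 1)²` rows-plus-dimension. [folklore] -/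
theorem collapse_card_le {t n Q s P : ℕ} (hP : P ≤ t * Q) (hQs : Q ≤ s + 1) :
    P + (t * (n + t) + (t * (n + t) + 1)) + (Q + 1) * (t + (t + t * (n + t))) ≤
      4 * (s + 3) * (t + n + 1) ^ 2 := by
  set M := t + n + 1 with hM
  have ht : t ≤ M := by omega
  have hnt : n + t ≤ M := by omega
  have hM1 : 1 ≤ M := by omega
  have h1 : t * Q ≤ (s + 1) * M ^ 2 := by
    calc t * Q ≤ M * (s + 1) := Nat.mul_le_mul ht hQs
      _ = (s + 1) * M * 1 := by ring
      _ ≤ (s + 1) * M * M := Nat.mul_le_mul_left _ hM1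
      _ = (s + 1) * M ^ 2 := by ring
  have h2 : t * (n + t) ≤ M ^ 2 := by
    calc t * (n + t) ≤ M * M := Nat.mul_le_mul ht hnt
      _ = M ^ 2 := by ring
  have h3 : 1 ≤ M ^ 2 := Nat.one_le_pow _ _ hM1
  have h4 : (Q + 1) * (t + (t + t * (n + t))) ≤ (s + 2) * (3 * M ^ 2) := by
    have : t + (t + t * (n + t)) ≤ 3 * M ^ 2 := by
      calc t + (t + t * (n + t)) ≤ M * 1 + M * 1 + M ^ 2 := by
            have := Nat.mul_le_mul ht hM1; omega
        _ ≤ M * M + M * M + M ^ 2 := by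
            have := Nat.mul_le_mul_left M hM1; omega
        _ = 3 * M ^ 2 := by ring
    exact Nat.mul_le_mul (by omega) this
  calc P + (t * (n + t) + (t * (n + t) + 1)) + (Q + 1) * (t + (t + t * (n + t)))
      ≤ (s + 1) * M ^ 2 + (M ^ 2 + (M ^ 2 + M ^ 2)) + (s + 2) * (3 * M ^ 2) := by
        have := hP.trans h1
        omega
    _ = (4 * s + 10) * M ^ 2 := by ring
    _ ≤ (4 * s + 12) * M ^ 2 := Nat.mul_le_mul_right _ (by omega)
    _ = 4 * (s + 3) * M ^ 2 := by ring

/-- **Collapse of CONV circuits to one CONV gate.** Every circuit with `t` gates over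
`{∧₂, ∨₂} ∪ CONV_s` on `n` input variables computes the same Boolean function as ONE CONV gate of
size parameter `4 (s + 3) (t + n + 1)²` wired to the inputs (the SDP-feasibility analogue of the
max-existential weak MLP representation of MLP circuits, Oliveira–Pudlák 2019, Thm. 4.3 / §7):
homogenise every gate's system by a level `z_j ≥ 0`, linearise `z_j · [wire u]` as `w_{j,u}` with
`w_{j,u} ≤ z_j`, `w_{j,u} ≤ z_u` (resp. `≤ [x_e]`), and demand `z_out ≥ 1`
(`ConvCollapse.eval_of_levels`, `ConvCollapse.exists_feasible`). [folklore] -/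
theorem exists_oneConvGate_of_isOver {ι : Type} [Fintype ι] {s : ℕ} (C : Circuit ι)
    (hC : C.IsOver ({GateFn.and 2, GateFn.or 2} ∪ {g | IsConvGate s g})) :
    ∃ g : GateFn, IsConvGate (4 * (s + 3) * (C.size + Fintype.card ι + 1) ^ 2) g ∧
      ∃ w : Fin g.1 → ι, ∀ x, g.2 (fun a => x (w a)) = C.eval x := by
  classical
  have hgate : ∀ j : Fin C.gates.length, IsConvGate (max s 1) (C.gates[j]).fn :=
    fun j => isConvGate_of_isOver C hC _ (List.getElem_mem j.isLt)
  choose p q hpq A b B hB hspec using hgate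
  have hQ : ∀ j, q j ≤ max s 1 := fun j => (Nat.le_add_left _ _).trans (hpq j)
  have hP : ∀ j, p j ≤ max s 1 := fun j => (Nat.le_add_right _ _).trans (hpq j)
  set eι := Fintype.equivFin ι
  -- normalised wires and coordinates
  set tw : Fin C.gates.length → ι ⊕ ℕ → ι ⊕ Fin C.gates.length := fun j w =>
    Sum.elim (fun e => Sum.inl e) (fun m => if h : m < C.gates.length then Sum.inr ⟨m, h⟩ else Sum.inr j) w
    with htw
  have htw_inl : ∀ j e, tw j (.inl e) = .inl e := fun j e => rfl
  have htw_inr : ∀ j m (hm : m < C.gates.length), tw j (.inr m) = .inr ⟨m, hm⟩ := fun j m hm => by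
    simp [htw, hm]
  -- the rows of the single system
  set rowA : ((Σ j : Fin C.gates.length, Fin (p j)) ⊕ ((Fin C.gates.length × (ι ⊕ Fin C.gates.length)) ⊕ ((Fin C.gates.length × (ι ⊕ Fin C.gates.length)) ⊕ Unit))) →
      Matrix (Fin (max s 1 + 1) × (Fin C.gates.length ⊕ (Fin C.gates.length ⊕ (Fin C.gates.length × (ι ⊕ Fin C.gates.length)))))
        (Fin (max s 1 + 1) × (Fin C.gates.length ⊕ (Fin C.gates.length ⊕ (Fin C.gates.length × (ι ⊕ Fin C.gates.length))))) ℝ := fun ρ => match ρ with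
    | .inl ⟨j, r⟩ =>
        (∑ i, ∑ i', A j r i i' •
          single ((Fin.castLE (Nat.le_succ_of_le (hQ j)) i, Sum.inl j))
            ((Fin.castLE (Nat.le_succ_of_le (hQ j)) i', Sum.inl j)) (1 : ℝ)) +
        (-(b j r)) • single ((0 : Fin (max s 1 + 1)), Sum.inr (Sum.inl j)) (0, Sum.inr (Sum.inl j)) (1 : ℝ) +
        ∑ a, (-(B j r a)) •
          single ((0 : Fin (max s 1 + 1)), Sum.inr (Sum.inr (j, tw j ((C.gates[j]).args a))))
            (0, Sum.inr (Sum.inr (j, tw j ((C.gates[j]).args a)))) (1 : ℝ)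
    | .inr (.inl (j, u)) =>
        single ((0 : Fin (max s 1 + 1)), Sum.inr (Sum.inr (j, u))) (0, Sum.inr (Sum.inr (j, u))) (1 : ℝ) +
          (-1 : ℝ) • single ((0 : Fin (max s 1 + 1)), Sum.inr (Sum.inl j)) (0, Sum.inr (Sum.inl j)) 1
    | .inr (.inr (.inl (j, .inl e))) =>
        single ((0 : Fin (max s 1 + 1)), Sum.inr (Sum.inr (j, Sum.inl e)))
          (0, Sum.inr (Sum.inr (j, Sum.inl e))) (1 : ℝ)
    | .inr (.inr (.inl (j, .inr m))) =>
        single ((0 : Fin (max s 1 + 1)), Sum.inr (Sum.inr (j, Sum.inr m)))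
            (0, Sum.inr (Sum.inr (j, Sum.inr m))) (1 : ℝ) +
          (-1 : ℝ) • single ((0 : Fin (max s 1 + 1)), Sum.inr (Sum.inl m)) (0, Sum.inr (Sum.inl m)) 1
    | .inr (.inr (.inr ())) =>
        match C.output with
        | .inl _ => 0
        | .inr m => if h : m < C.gates.length then
            (-1 : ℝ) • single ((0 : Fin (max s 1 + 1)), Sum.inr (Sum.inl (⟨m, h⟩ : Fin C.gates.length)))
              (0, Sum.inr (Sum.inl ⟨m, h⟩)) 1 else 0
    with hrowA
  set rowb : ((Σ j : Fin C.gates.length, Fin (p j)) ⊕ ((Fin C.gates.length × (ι ⊕ Fin C.gates.length)) ⊕ ((Fin C.gates.length × (ι ⊕ Fin C.gates.length)) ⊕ Unit))) →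
      ℝ := fun ρ => match ρ with
    | .inr (.inr (.inr ())) => -1
    | _ => 0
    with hrowb
  set rowB : ((Σ j : Fin C.gates.length, Fin (p j)) ⊕ ((Fin C.gates.length × (ι ⊕ Fin C.gates.length)) ⊕ ((Fin C.gates.length × (ι ⊕ Fin C.gates.length)) ⊕ Unit))) →
      ι → ℝ := fun ρ => match ρ with
    | .inr (.inr (.inl (_, .inl e))) => fun e' => if e' = e then 1 else 0
    | .inr (.inr (.inr ())) =>
        match C.output with
        | .inl e => fun e' => if e' = e then 1 else 0
        | .inr _ => 0
    | _ => 0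
    with hrowB
  -- evaluation of the rows
  have evG : ∀ Y (j : Fin C.gates.length) (r : Fin (p j)), (rowA (.inl ⟨j, r⟩) * Y).trace =
      (A j r * Y.submatrix (fun i => (Fin.castLE (Nat.le_succ_of_le (hQ j)) i, Sum.inl j))
        (fun i => (Fin.castLE (Nat.le_succ_of_le (hQ j)) i, Sum.inl j))).trace -
      b j r * Y (0, .inr (.inl j)) (0, .inr (.inl j)) -
      ∑ a, B j r a * Y (0, .inr (.inr (j, tw j ((C.gates[j]).args a))))
        (0, .inr (.inr (j, tw j ((C.gates[j]).args a)))) := by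
    intro Y j r
    simp only [hrowA, Matrix.add_mul, Matrix.sum_mul, Matrix.smul_mul, trace_add, trace_sum,
      trace_smul, trace_single_one_mul, smul_eq_mul]
    have h1 : (A j r * Y.submatrix (fun i => (Fin.castLE (Nat.le_succ_of_le (hQ j)) i, Sum.inl j))
        (fun i => (Fin.castLE (Nat.le_succ_of_le (hQ j)) i, Sum.inl j))).trace =
        ∑ i, ∑ i', A j r i i' * Y (Fin.castLE (Nat.le_succ_of_le (hQ j)) i', Sum.inl j)
          (Fin.castLE (Nat.le_succ_of_le (hQ j)) i, Sum.inl j) := by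
      simp only [Matrix.trace, Matrix.diag_apply, Matrix.mul_apply, Matrix.submatrix_apply]
    rw [h1]
    simp only [neg_mul, Finset.sum_neg_distrib]
    ring
  have evZ : ∀ Y (j : Fin C.gates.length) (u : ι ⊕ Fin C.gates.length), (rowA (.inr (.inl (j, u))) * Y).trace =
      Y (0, .inr (.inr (j, u))) (0, .inr (.inr (j, u))) - Y (0, .inr (.inl j)) (0, .inr (.inl j)) := by
    intro Y j u
    simp only [hrowA, Matrix.add_mul, Matrix.smul_mul, trace_add, trace_smul, trace_single_one_mul,
      smul_eq_mul]
    ring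
  have evI : ∀ Y (j : Fin C.gates.length) (e : ι), (rowA (.inr (.inr (.inl (j, .inl e)))) * Y).trace =
      Y (0, .inr (.inr (j, .inl e))) (0, .inr (.inr (j, .inl e))) := by
    intro Y j e
    simp only [hrowA, trace_single_one_mul]
  have evR : ∀ Y (j m : Fin C.gates.length), (rowA (.inr (.inr (.inl (j, .inr m)))) * Y).trace =
      Y (0, .inr (.inr (j, .inr m))) (0, .inr (.inr (j, .inr m))) -
        Y (0, .inr (.inl m)) (0, .inr (.inl m)) := by
    intro Y j m
    simp only [hrowA, Matrix.add_mul, Matrix.smul_mul, trace_add, trace_smul, trace_single_one_mul,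
      smul_eq_mul]
    ring
  -- right-hand sides
  have rhs0 : ∀ (f : ι → ℝ) ρ, (∀ j e, ρ ≠ .inr (.inr (.inl (j, .inl e)))) →
      ρ ≠ .inr (.inr (.inr ())) → rowb ρ + ∑ e, rowB ρ e * f e = 0 := by
    intro f ρ h1 h2
    rcases ρ with ⟨j, r⟩ | ⟨j, u⟩ | ⟨j, e | m⟩ | ⟨⟨⟩⟩
    · simp [hrowb, hrowB]
    · simp [hrowb, hrowB]
    · exact absurd rfl (h1 j e)
    · simp [hrowb, hrowB]
    · exact absurd rfl h2
  have rhsI : ∀ (f : ι → ℝ) (j : Fin C.gates.length) (e : ι),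
      rowb (.inr (.inr (.inl (j, .inl e)))) +
        ∑ e', rowB (.inr (.inr (.inl (j, .inl e)))) e' * f e' = f e := by
    intro f j e
    simp only [hrowb, hrowB, ite_mul, one_mul, zero_mul, Finset.sum_ite_eq', Finset.mem_univ,
      if_true, zero_add]
  -- the gate
  refine ⟨⟨Fintype.card ι, fun v => C.eval (fun e => v (eι e))⟩, ?_, fun a => eι.symm a, fun x => ?_⟩
  swap
  · change C.eval (fun e => x (eι.symm (eι e))) = C.eval x
    simp only [Equiv.symm_apply_apply]
  refine isConvGate_of_indexed rowA rowb (fun ρ a => rowB ρ (eι.symm a)) ?_ (fun v => ?_) ?_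
  · -- `B ≥ 0`
    rintro (⟨j, r⟩ | ⟨j, u⟩ | ⟨j, e | m⟩ | ⟨⟨⟩⟩) a
    · simp [hrowB]
    · simp [hrowB]
    · simp only [hrowB]; split_ifs <;> norm_num
    · simp [hrowB]
    · simp only [hrowB]
      rcases C.output with e' | m
      · simp only
        split_ifs <;> norm_num
      · simp
  · -- acceptance iff feasibility
    have hsum : ∀ ρ, ∑ a, rowB ρ (eι.symm a) * (if v a then (1 : ℝ) else 0)
        = ∑ e, rowB ρ e * (if v (eι e) then (1 : ℝ) else 0) := fun ρ => by
      rw [← Equiv.sum_comp eι]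
      simp only [Equiv.symm_apply_apply]
    simp only [hsum]
    set x : ι → Bool := fun e => v (eι e) with hx
    change C.eval x = true ↔ _
    constructor
    · -- completeness
      intro hev
      obtain ⟨Y, hY, hG, hZ, hI, hR, hO⟩ :=
        ConvCollapse.exists_feasible p q A b B hspec tw hQ htw_inl htw_inr x hev
      refine ⟨Y, hY, ?_⟩
      rintro (⟨j, r⟩ | ⟨j, u⟩ | ⟨j, e | m⟩ | ⟨⟨⟩⟩)
      · rw [evG, rhs0 (fun e => if v (eι e) then (1 : ℝ) else 0) (.inl ⟨j, r⟩) (fun _ _ h => by cases h) (fun h => by cases h)]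
        have := hG j r
        linarith
      · rw [evZ, rhs0 (fun e => if v (eι e) then (1 : ℝ) else 0) (.inr (.inl (j, u))) (fun _ _ h => by cases h) (fun h => by cases h),
          sub_nonpos]
        exact hZ j u
      · rw [evI, rhsI (fun e => if v (eι e) then (1 : ℝ) else 0) j e]
        exact hI j e
      · rw [evR, rhs0 (fun e => if v (eι e) then (1 : ℝ) else 0) (.inr (.inr (.inl (j, .inr m)))) (fun _ _ h => by cases h)
          (fun h => by cases h), sub_nonpos]
        exact hR j m
      · -- output row
        simp only [hrowA, hrowb, hrowB]
        have hev' := hev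
        rw [eval_eq_wireVal] at hev'
        revert hO hev'
        rcases hCo : C.output with e | m
        · intro _ hev'
          change v (eι e) = true at hev'
          simp only [trace_zero, ite_mul, one_mul, zero_mul, Finset.sum_ite_eq',
            Finset.mem_univ, if_true, hev']
          norm_num
        · intro hO _
          have hm : m < C.gates.length := C.wf_output m hCo
          have h1 := hO m hm rfl
          simp only [hm, ↓reduceDIte, Matrix.smul_mul, trace_smul, smul_eq_mul,
            trace_single_one_mul, Pi.zero_apply, zero_mul, Finset.sum_const_zero, add_zero]
          linarith
    · -- soundness
      rintro ⟨Y, hY, hrows⟩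
      refine ConvCollapse.eval_of_levels p q A b B hB hspec Y
        (fun j i => (Fin.castLE (Nat.le_succ_of_le (hQ j)) i, Sum.inl j))
        (fun j => (0, .inr (.inl j))) (fun j u => (0, .inr (.inr (j, u)))) tw hY htw_inl htw_inr x
        (fun j r => ?_) (fun j u => ?_) (fun j e => ?_) (fun j m => ?_) (fun m hm hCo => ?_)
        (fun e hCo => ?_)
      · have h := hrows (.inl ⟨j, r⟩)
        rw [evG, rhs0 (fun e => if v (eι e) then (1 : ℝ) else 0) (.inl ⟨j, r⟩) (fun _ _ h => by cases h) (fun h => by cases h)] at h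
        linarith
      · have h := hrows (.inr (.inl (j, u)))
        rw [evZ, rhs0 (fun e => if v (eι e) then (1 : ℝ) else 0) (.inr (.inl (j, u))) (fun _ _ h => by cases h) (fun h => by cases h)] at h
        linarith
      · have h := hrows (.inr (.inr (.inl (j, .inl e))))
        rwa [evI, rhsI (fun e => if v (eι e) then (1 : ℝ) else 0) j e] at h
      · have h := hrows (.inr (.inr (.inl (j, .inr m))))
        rw [evR, rhs0 (fun e => if v (eι e) then (1 : ℝ) else 0) (.inr (.inr (.inl (j, .inr m)))) (fun _ _ h => by cases h)
          (fun h => by cases h)] at h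
        linarith
      · have h := hrows (.inr (.inr (.inr ())))
        simp only [hrowA, hrowb, hrowB, hCo, hm, ↓reduceDIte, Matrix.smul_mul, trace_smul,
          smul_eq_mul, trace_single_one_mul, Pi.zero_apply, zero_mul, Finset.sum_const_zero,
          add_zero] at h
        linarith
      · have h := hrows (.inr (.inr (.inr ())))
        simp only [hrowA, hrowb, hrowB, hCo, trace_zero, ite_mul, one_mul,
          zero_mul, Finset.sum_ite_eq', Finset.mem_univ, if_true] at h
        by_contra hxe
        rw [if_neg hxe] at h
        linarith
  · -- size
    have hcardR : Fintype.card ((Σ j : Fin C.gates.length, Fin (p j)) ⊕ ((Fin C.gates.length × (ι ⊕ Fin C.gates.length)) ⊕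
        ((Fin C.gates.length × (ι ⊕ Fin C.gates.length)) ⊕ Unit))) =
        (∑ j : Fin C.gates.length, p j) + (C.gates.length * (Fintype.card ι + C.gates.length) + (C.gates.length * (Fintype.card ι + C.gates.length) + 1)) := by
      simp only [Fintype.card_sum, Fintype.card_sigma, Fintype.card_fin, Fintype.card_prod,
        Fintype.card_unit]
    have hcardV : Fintype.card (Fin (max s 1 + 1) × (Fin C.gates.length ⊕ (Fin C.gates.length ⊕ (Fin C.gates.length × (ι ⊕ Fin C.gates.length))))) =
        (max s 1 + 1) * (C.gates.length + (C.gates.length + C.gates.length * (Fintype.card ι + C.gates.length))) := by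
      simp only [Fintype.card_sum, Fintype.card_fin, Fintype.card_prod]
    rw [hcardR, hcardV]
    have hsumP : (∑ j : Fin C.gates.length, p j) ≤ C.gates.length * max s 1 :=
      calc (∑ j : Fin C.gates.length, p j) ≤ ∑ _j : Fin C.gates.length, max s 1 :=
            Finset.sum_le_sum fun j _ => hP j
        _ = C.gates.length * max s 1 := by simp
    exact collapse_card_le hsumP (by omega)

/-- **Circuit form of the collapse.** Every `{∧₂, ∨₂} ∪ CONV_s` circuit with `t` gates on `n`
inputs is equivalent to a circuit with at most ONE gate over `CONV_{4(s+3)(t+n+1)²}`. [folklore] -/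
theorem exists_oneGateCircuit_of_isOver {ι : Type} [Fintype ι] {s : ℕ} (C : Circuit ι)
    (hC : C.IsOver ({GateFn.and 2, GateFn.or 2} ∪ {g | IsConvGate s g})) :
    ∃ C₁ : Circuit ι, C₁.IsOver {g | IsConvGate (4 * (s + 3) * (C.size + Fintype.card ι + 1) ^ 2) g} ∧
      C₁.size ≤ 1 ∧ ∀ x, C₁.eval x = C.eval x := by
  obtain ⟨g, hg, w, hw⟩ := exists_oneConvGate_of_isOver C hC
  obtain ⟨C₁, h₁, hs₁, he₁⟩ :=
    (CktSize.gate (B := {g | IsConvGate (4 * (s + 3) * (C.size + Fintype.card ι + 1) ^ 2) g})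
      g hg w).toCircuit
  exact ⟨C₁, h₁, hs₁, fun x => (he₁ x).trans (hw x)⟩

end Summit.PneNP.PneNP.Theorems
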